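import Literature.NumberTheory.Automorphic.UnitaryGroupSiegelFiniteShadow
import Literature.NumberTheory.Automorphic.UnitaryGroupHeisenbergConjLevelDilated
import Literature.NumberTheory.Automorphic.FiniteAdeleCompactValuationDepth
import HarnessLib

/-!
# The level depth on the Siegel set of `U(3)`: a rational dilation `t_m` making `π(b⁻¹ u b) ≡ 1 (mod 𝔫)`
# for all `b` in the Siegel set and all `u` in the dilated fundamental domain `t_m⁻¹ 𝓕_N t_m`
(Rogawski, *Automorphic Representations of Unitary Groups in Three Variables* (1990), §2.2 (p. 13); Tate,
*Fourier analysis in number fields* = Cassels–Fröhlich Ch. XV; Cassels, *Global fields*, ibid. Ch. II §16)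

Topic `NumberTheory/Automorphic`; namespace `Literature.NumberTheory.Automorphic.UnitaryGroup`. THEOREMS ONLY
(kernel lane: no definition, no named fact, no instance, no notation, no `sorry`). Row Δ2 «m-DEPTH» of the T1-qs
sub-line (integrability of Arthur's truncated kernel on `U(J₃)`, ★ `UnitaryGroup.TruncatedKernelIntegrable`) of
`Cruxes/H413/Lines/F0_T1InnerFormTraceIdentity.lean` (F0P3a-p05 (g5)'s cut 07:58Z∕08:13Z): the LAST HYPOTHESIS
`hdepth` of ★ `truncatedKernelIntegrable_of_levelDepth` (`UnitaryGroupTruncatedKernelIntegrableOfSiegel`),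
discharged.

THE POINT. The oscillation bound for `k^T` (H5) needs, for each level `𝔫` of the test function, a fundamental domain
`𝓕₀` of `N(F)` such that `b⁻¹ u b ∈ K(𝔫)`-ish at the finite places for every `b` in the Siegel set `S = Ω · S_T · K_B`
and `u ∈ 𝓕₀` (the `hval` premise of ★ 2D `exists_isCompact_forall_threeFactor`). A-p13's ★ 2E
`hval_of_mem_torusConj_image` reduces this, on the DILATED domain `t⁻¹ 𝓕_N t` (root value `d₀(t)⁻¹d₁(t) = M`,
`c`-fixed), to TEN valuation inequalities per finite place `v` in `|M|_v`, the root values `d₀⁻¹d₁, d₁⁻¹d₂, d₀⁻¹d₂` of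
`b`, the Heisenberg coordinate `x₀(b)` of the unipotent part of `b`, its conjugate, and `|½|_v` (five at `𝔫`, five at
`c⁻¹ • 𝔫`). This file makes the ARITHMETIC CHOICE `M = m ∈ ℕ` (`t = t_m = diag(m⁻¹, 1, m)` rational, ★
`exists_rational_torus_diag`):

* §1–§2 = the companion ★ `UnitaryGroupSiegelFiniteShadow` (algebra of `diagUnit`∕root values∕unipotent parts of
  products in `B(𝔸_F)`; the finite components of `d₀⁻¹d₁(b)` and `x₀(b)` on the Siegel set lie in a compact of
  `𝔸_E^∞`, from the EXPORT alone — no `Ω ⊆ N(𝔸_F)`, no height guard).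
* §3 THE CHOICE OF `m` (this file): ★ `exists_finset_nat_forall_valued_le_of_isCompact` (A-p09: valuations of a compact of
  `𝔸_E^∞` are `≤ 1` off a finite `T` and `≤ exp n` everywhere — applied to the two shadows and `{½}`), the other two
  root values via `d₁⁻¹d₂ = c(d₀⁻¹d₁)`, `d₀⁻¹d₂ = (d₀⁻¹d₁)(d₁⁻¹d₂)` (★ `conjAdele_rootOne_eq`) and `|c(e)_v| = |e_{c⁻¹v}|`
  (★ `valued_galAdicCompletionMap`), then ★ `exists_natCast_valued_mul_exp_le` (A-p09: `m ∈ ℕ`, `|m|_v ≤ 1`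
  everywhere, `|m|_v · exp(3n) ≤ min (|𝔫|_v, |c⁻¹𝔫|_v)` on `T ∪ c•T ∪ supp 𝔫 ∪ supp c⁻¹𝔫`); off that set every
  factor is `≤ 1 = |𝔫|_v` (★ `idealRadius_eq_one_of_not_dvd`).
* `exists_rational_borel_forall_valuation_conj_le_of_letters` (the two A-p09 letters as hypotheses) and
  **`exists_rational_borel_forall_valuation_conj_le`** = `hdepth` VERBATIM (binder text of
  `UnitaryGroupTruncatedKernelIntegrableOfSiegel` :179–:199).

## References
* J. D. Rogawski, *Automorphic Representations of Unitary Groups in Three Variables*, Ann. of Math. Stud. 123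
  (1990), §1.10, §2.2 (p. 13) [Rogawski1990].
* J. W. S. Cassels, A. Fröhlich (eds.), *Algebraic Number Theory* (1967), Ch. II §16 (restricted topological
  products), Ch. VII §1.1, Ch. XV [CasselsFrohlichANT1967].
* J. R. Getz, H. Hahn, *An Introduction to Automorphic Representations* (2024), §2.7 [GetzHahn2024].
-/

set_option autoImplicit false

noncomputable section

open Matrix NumberField IsDedekindDomain Topology Set
open scoped MatrixGroups Pointwise NNReal

namespace Literature.NumberTheory.Automorphic

namespace UnitaryGroup

variable {F E : Type} [Field F] [NumberField F] [Field E] [NumberField E] [Algebra F E]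
  {c : E ≃ₐ[F] E}

/-! ## §3 The level depth: the arithmetic choice of `m` -/

section Depth

omit [NumberField F] in
/-- Valuation transport under `c ⊗ 1`: `|c(e)_v| = |e_{c⁻¹ v}|`. [cite: CasselsFrohlichANT1967, Ch. VII §1.1] -/
private theorem valued_conjAdele_snd (e : AdeleRing (𝓞 E) E) (v : HeightOneSpectrum (𝓞 E)) :
    Valued.v ((conjAdele F E c e).2 v) = Valued.v (e.2 (c⁻¹ • v)) := by
  rw [conjAdele_apply, AdeleRing.smul_snd, FiniteAdeleRing.smul_apply, valued_galAdicCompletionMap]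

omit [NumberField F] in
/-- The principal adele of a natural number has component `m` at every finite place. [folklore] -/
private theorem valued_snd_algebraMap_natCast (m : ℕ) (v : HeightOneSpectrum (𝓞 E)) :
    Valued.v ((algebraMap E (AdeleRing (𝓞 E) E) (algebraMap F E (m : F))).2 v) =
      Valued.v ((m : v.adicCompletion E)) := by
  rw [map_natCast, map_natCast]
  rfl

omit [NumberField F] [Algebra F E] in
/-- `|𝔫|_v ≠ 0` (it is an `exp`). [folklore] -/
private theorem idealRadius_ne_zero' (v : HeightOneSpectrum (𝓞 E)) (𝔫 : Ideal (𝓞 E)) : idealRadius E v 𝔫 ≠ 0 := by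
  unfold idealRadius
  exact WithZero.exp_ne_zero

/-- **THE LEVEL DEPTH ON THE SIEGEL SET (`hdepth` of ★ `truncatedKernelIntegrable_of_levelDepth`), from the two
generic valuation letters.**  See `exists_rational_borel_forall_valuation_conj_le` for the statement; here the
inputs «valuations are bounded on a compact of `𝔸_E^∞` and `≤ 1` off a finite set» (`hA1`) and «a natural number
`m` with `|m|_v ≤ 1` everywhere and `|m|_v` as small as prescribed on a finite set» (`hA2`) are hypotheses.
[cite: Rogawski1990, §2.2 (p. 13)] [cite: CasselsFrohlichANT1967, Ch. II §16] -/
theorem exists_rational_borel_forall_valuation_conj_le_of_letters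
    (hA1 : ∀ {C : Set (FiniteAdeleRing (𝓞 E) E)}, IsCompact C →
      ∃ T : Finset (HeightOneSpectrum (𝓞 E)), ∃ n : ℕ,
        (∀ x ∈ C, ∀ v : HeightOneSpectrum (𝓞 E), v ∉ T → Valued.v (x v) ≤ 1) ∧
        (∀ x ∈ C, ∀ v : HeightOneSpectrum (𝓞 E), Valued.v (x v) ≤ WithZero.exp (n : ℤ)))
    (hA2 : ∀ (T : Finset (HeightOneSpectrum (𝓞 E))) (n : ℕ)
      (r : HeightOneSpectrum (𝓞 E) → WithZero (Multiplicative ℤ)), (∀ v ∈ T, r v ≠ 0) →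
      ∃ m : ℕ, m ≠ 0 ∧ (∀ v : HeightOneSpectrum (𝓞 E), Valued.v ((m : v.adicCompletion E)) ≤ 1) ∧
        ∀ v ∈ T, Valued.v ((m : v.adicCompletion E)) * WithZero.exp (n : ℤ) ≤ r v)
    (hc : c * c = 1) {Ω ST : Set (borelAdelic F E c 3)} (hΩ : IsCompact Ω) {W : Set (AdeleRing (𝓞 E) E)ˣ}
    (hW : IsCompact W) (hSTt : ∀ t ∈ ST, torusPart t = t)
    (hexp : ∀ t ∈ ST, ∃ w ∈ W, ∃ r : ℝ≥0ˣ, diagUnit t.2 0 = w * posRealIdele E r ∧ diagUnit t.2 1 ∈ W)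
    {𝔫 : Ideal (𝓞 E)} (h𝔫 : 𝔫 ≠ 0) :
    ∃ β : borelAdelic F E c 3, (β : (quasiSplit F E c 3).Adelic) ∈ (quasiSplit F E c 3).arithmeticSubgroup ∧
      ∀ b ∈ Ω * ST * {k : borelAdelic F E c 3 |
          adelicVal F E c 3 ((StdForm.antidiagonal 3).over E) (k : (quasiSplit F E c 3).Adelic) ∈
            standardMaximalCompactGL 3 E},
      1 ≤ borelHeight (b : (quasiSplit F E c 3).Adelic) →
      ∀ u ∈ (fun v : adelicUnipotent F E c 3 =>
          (⟨(β : (quasiSplit F E c 3).Adelic)⁻¹ * (v : (quasiSplit F E c 3).Adelic) * (β : (quasiSplit F E c 3).Adelic),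
            borel_inv_mul_mul_mem_adelicUnipotent β v⟩ : adelicUnipotent F E c 3)) '' heisFundamentalDomain F E c hc,
        ∀ i j : Fin 3, i ≠ j → ∀ v : HeightOneSpectrum (𝓞 E),
          Valued.v ((((adelicVal F E c 3 _ ((b : (quasiSplit F E c 3).Adelic)⁻¹ *
              (u : (quasiSplit F E c 3).Adelic) * (b : (quasiSplit F E c 3).Adelic)) :
            GL (Fin 3) (AdeleRing (𝓞 E) E)) : Matrix (Fin 3) (Fin 3) (AdeleRing (𝓞 E) E)) i j).2 v) ≤
              idealRadius E v 𝔫 ∧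
          Valued.v ((conjAdele F E c (((adelicVal F E c 3 _ ((b : (quasiSplit F E c 3).Adelic)⁻¹ *
              (u : (quasiSplit F E c 3).Adelic) * (b : (quasiSplit F E c 3).Adelic)) :
            GL (Fin 3) (AdeleRing (𝓞 E) E)) : Matrix (Fin 3) (Fin 3) (AdeleRing (𝓞 E) E)) i j)).2 v) ≤
              idealRadius E v 𝔫 := by
  classical
  -- §2: the finite shadows of the root value and of `x₀` on the Siegel set are compact
  obtain ⟨Cα, hCαc, hαmem⟩ := exists_isCompact_snd_rootValue_mem (ST := ST) hΩ hW hexp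
  obtain ⟨Cx, hCxc, hxmem⟩ := exists_isCompact_snd_coordX_mem hΩ hW hSTt hexp
  -- `hA1` on `Cα ∪ Cx ∪ {½}`
  obtain ⟨T, n, hT1, hTn⟩ := hA1 ((hCαc.union hCxc).union
    (isCompact_singleton (x := (halfAdele : AdeleRing (𝓞 E) E).2)))
  -- the bad set of places and the prescribed radii
  have h𝔫' : c⁻¹ • 𝔫 ≠ 0 := fun h => h𝔫 ((Ideal.smul_eq_bot_iff c⁻¹ 𝔫).1 h)
  set T' : Finset (HeightOneSpectrum (𝓞 E)) := T ∪ T.image (fun v => c • v) ∪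
    (Ideal.finite_factors h𝔫).toFinset ∪ (Ideal.finite_factors h𝔫').toFinset with hT'
  set r : HeightOneSpectrum (𝓞 E) → WithZero (Multiplicative ℤ) := fun v =>
    min (idealRadius E v 𝔫) (idealRadius E v (c⁻¹ • 𝔫)) with hr
  have hr0 : ∀ v ∈ T', r v ≠ 0 := fun v _ => by
    rcases min_choice (idealRadius E v 𝔫) (idealRadius E v (c⁻¹ • 𝔫)) with h | h
    · rw [hr]; simp only; rw [h]; exact idealRadius_ne_zero' v 𝔫
    · rw [hr]; simp only; rw [h]; exact idealRadius_ne_zero' v _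
  obtain ⟨m, hm0, hm1, hmT⟩ := hA2 T' (3 * n) r hr0
  -- the rational torus element `t_m`
  have hmF : (m : F) ≠ 0 := Nat.cast_ne_zero.2 hm0
  obtain ⟨t, hrat, htor, hd0, hd1, -⟩ := exists_rational_torus_diag (F := F) (E := E) (c := c) (m : F) hmF
  have hmE : algebraMap F E (m : F) ≠ 0 := (map_ne_zero (algebraMap F E)).2 hmF
  have hM : ((((diagUnit t.2 0)⁻¹ * diagUnit t.2 1 : (AdeleRing (𝓞 E) E)ˣ)) : AdeleRing (𝓞 E) E) =
      algebraMap E (AdeleRing (𝓞 E) E) (algebraMap F E (m : F)) := by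
    have hinv : (((diagUnit t.2 0)⁻¹ : (AdeleRing (𝓞 E) E)ˣ) : AdeleRing (𝓞 E) E) =
        algebraMap E (AdeleRing (𝓞 E) E) (algebraMap F E (m : F)) := by
      refine Units.inv_eq_of_mul_eq_one_left ?_
      rw [hd0, ← map_mul, mul_inv_cancel₀ hmE, map_one]
    rw [Units.val_mul, hinv, hd1, mul_one]
  have hfix : conjAdele F E c ((((diagUnit t.2 0)⁻¹ * diagUnit t.2 1 : (AdeleRing (𝓞 E) E)ˣ)) : AdeleRing (𝓞 E) E) =
      ((((diagUnit t.2 0)⁻¹ * diagUnit t.2 1 : (AdeleRing (𝓞 E) E)ˣ)) : AdeleRing (𝓞 E) E) := by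
    rw [hM, ← algebraMap_conj, RingHom.coe_coe, AlgEquiv.commutes]
  have hMv : ∀ v : HeightOneSpectrum (𝓞 E),
      Valued.v ((((((diagUnit t.2 0)⁻¹ * diagUnit t.2 1 : (AdeleRing (𝓞 E) E)ˣ)) : AdeleRing (𝓞 E) E)).2 v) =
        Valued.v ((m : v.adicCompletion E)) := fun v => by
    rw [hM, valued_snd_algebraMap_natCast]
  refine ⟨t, hrat, fun b hb _ u hu => ?_⟩
  -- the per-place bounds on the data of `b`
  have hCsub : ∀ {x : FiniteAdeleRing (𝓞 E) E}, x ∈ Cα ∨ x ∈ Cx ∨ x = (halfAdele : AdeleRing (𝓞 E) E).2 →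
      x ∈ Cα ∪ Cx ∪ {(halfAdele : AdeleRing (𝓞 E) E).2} := by
    rintro x (h | h | h)
    · exact Or.inl (Or.inl h)
    · exact Or.inl (Or.inr h)
    · exact Or.inr h
  set α : AdeleRing (𝓞 E) E := ((((diagUnit b.2 0)⁻¹ * diagUnit b.2 1 : (AdeleRing (𝓞 E) E)ˣ)) : AdeleRing (𝓞 E) E)
    with hα
  set x₀ : AdeleRing (𝓞 E) E := coordX (⟨(((torusPart b)⁻¹ * b : borelAdelic F E c 3) : (quasiSplit F E c 3).Adelic),
    torusPart_inv_mul_mem_adelicUnipotent b⟩ : adelicUnipotent F E c 3) with hx₀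
  have hαC := hCsub (Or.inl (hαmem b hb))
  have hxC := hCsub (Or.inr (Or.inl (hxmem b hb)))
  have hhC := hCsub (x := (halfAdele : AdeleRing (𝓞 E) E).2) (Or.inr (Or.inr rfl))
  -- the root values `γ = c(α)`, `β = α γ`
  obtain ⟨hγ, hβ⟩ := conjAdele_rootOne_eq (F := F) (E := E) (c := c) b
  -- bookkeeping in `ℤₘ₀`
  have hexp1 : (1 : WithZero (Multiplicative ℤ)) ≤ WithZero.exp (n : ℤ) := by
    rw [← WithZero.exp_zero]; exact WithZero.exp_le_exp.2 (by positivity)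
  have hexp3 : WithZero.exp (n : ℤ) * WithZero.exp (n : ℤ) * WithZero.exp (n : ℤ) = WithZero.exp ((3 * n : ℕ) : ℤ) := by
    rw [← WithZero.exp_add, ← WithZero.exp_add]; congr 1; push_cast; ring
  -- the key step: `|m|_v · X ≤ |𝔩|_v` for both levels from `X ≤ exp (3n)` and `X ≤ 1` off `T'`
  have key : ∀ v : HeightOneSpectrum (𝓞 E), ∀ X : WithZero (Multiplicative ℤ),
      X ≤ WithZero.exp (n : ℤ) * WithZero.exp (n : ℤ) * WithZero.exp (n : ℤ) → (v ∉ T' → X ≤ 1) →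
      Valued.v ((m : v.adicCompletion E)) * X ≤ idealRadius E v 𝔫 ∧
        Valued.v ((m : v.adicCompletion E)) * X ≤ idealRadius E v (c⁻¹ • 𝔫) := by
    intro v X hX3 hX1
    by_cases hv : v ∈ T'
    · have h := hmT v hv
      rw [hexp3] at hX3
      have h2 : Valued.v ((m : v.adicCompletion E)) * X ≤ r v :=
        (mul_le_mul' le_rfl hX3).trans h
      exact ⟨h2.trans (min_le_left _ _), h2.trans (min_le_right _ _)⟩
    · have hvT : v ∉ T := fun h => hv (by rw [hT']; simp [h])
      have hv𝔫 : ¬ v.asIdeal ∣ 𝔫 := fun h => hv (by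
        rw [hT']; simp only [Finset.mem_union, Set.Finite.mem_toFinset, Set.mem_setOf_eq]; exact Or.inl (Or.inr h))
      have hv𝔫' : ¬ v.asIdeal ∣ c⁻¹ • 𝔫 := fun h => hv (by
        rw [hT']; simp only [Finset.mem_union, Set.Finite.mem_toFinset, Set.mem_setOf_eq]; exact Or.inr h)
      rw [idealRadius_eq_one_of_not_dvd h𝔫 hv𝔫, idealRadius_eq_one_of_not_dvd h𝔫' hv𝔫']
      have h1 : Valued.v ((m : v.adicCompletion E)) * X ≤ 1 := mul_le_one' (hm1 v) (hX1 hv)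
      exact ⟨h1, h1⟩
  -- the five factors: bounds everywhere and off `T'`
  have hαn : ∀ v, Valued.v (α.2 v) ≤ WithZero.exp (n : ℤ) := fun v => hTn _ hαC v
  have hα1 : ∀ v, v ∉ T' → Valued.v (α.2 v) ≤ 1 := fun v hv =>
    hT1 _ hαC v fun h => hv (by rw [hT']; simp [h])
  have hγn : ∀ v, Valued.v ((((((diagUnit b.2 1)⁻¹ * diagUnit b.2 2 : (AdeleRing (𝓞 E) E)ˣ)) : AdeleRing (𝓞 E) E)).2 v) ≤
      WithZero.exp (n : ℤ) := fun v => by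
    rw [← hγ, valued_conjAdele_snd]; exact hTn _ hαC _
  have hγ1 : ∀ v, v ∉ T' → Valued.v ((((((diagUnit b.2 1)⁻¹ * diagUnit b.2 2 : (AdeleRing (𝓞 E) E)ˣ)) :
      AdeleRing (𝓞 E) E)).2 v) ≤ 1 := fun v hv => by
    rw [← hγ, valued_conjAdele_snd]
    refine hT1 _ hαC _ fun h => hv ?_
    rw [hT']
    simp only [Finset.mem_union, Finset.mem_image]
    exact Or.inl (Or.inl (Or.inr ⟨c⁻¹ • v, h, smul_inv_smul c v⟩))
  have hβeq : ∀ v, Valued.v ((((((diagUnit b.2 0)⁻¹ * diagUnit b.2 2 : (AdeleRing (𝓞 E) E)ˣ)) : AdeleRing (𝓞 E) E)).2 v) =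
      Valued.v (α.2 v) * Valued.v ((((((diagUnit b.2 1)⁻¹ * diagUnit b.2 2 : (AdeleRing (𝓞 E) E)ˣ)) :
        AdeleRing (𝓞 E) E)).2 v) := fun v => by
    rw [← hβ, ← map_mul]; rfl
  have hxn : ∀ v, Valued.v (x₀.2 v) ≤ WithZero.exp (n : ℤ) := fun v => hTn _ hxC v
  have hx1 : ∀ v, v ∉ T' → Valued.v (x₀.2 v) ≤ 1 := fun v hv =>
    hT1 _ hxC v fun h => hv (by rw [hT']; simp [h])
  have hcxn : ∀ v, Valued.v ((conjAdele F E c x₀).2 v) ≤ WithZero.exp (n : ℤ) := fun v => by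
    rw [valued_conjAdele_snd]; exact hTn _ hxC _
  have hcx1 : ∀ v, v ∉ T' → Valued.v ((conjAdele F E c x₀).2 v) ≤ 1 := fun v hv => by
    rw [valued_conjAdele_snd]
    refine hT1 _ hxC _ fun h => hv ?_
    rw [hT']
    simp only [Finset.mem_union, Finset.mem_image]
    exact Or.inl (Or.inl (Or.inr ⟨c⁻¹ • v, h, smul_inv_smul c v⟩))
  have hhn : ∀ v, Valued.v ((halfAdele : AdeleRing (𝓞 E) E).2 v) ≤ WithZero.exp (n : ℤ) := fun v => hTn _ hhC v
  have hh1 : ∀ v, v ∉ T' → Valued.v ((halfAdele : AdeleRing (𝓞 E) E).2 v) ≤ 1 := fun v hv =>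
    hT1 _ hhC v fun h => hv (by rw [hT']; simp [h])
  -- the ten inequalities
  have five : ∀ 𝔩 : Ideal (𝓞 E), (𝔩 = 𝔫 ∨ 𝔩 = c⁻¹ • 𝔫) → ∀ v : HeightOneSpectrum (𝓞 E),
      Valued.v ((m : v.adicCompletion E)) * Valued.v (α.2 v) ≤ idealRadius E v 𝔩 ∧
      Valued.v ((m : v.adicCompletion E)) * Valued.v ((((((diagUnit b.2 1)⁻¹ * diagUnit b.2 2 :
        (AdeleRing (𝓞 E) E)ˣ)) : AdeleRing (𝓞 E) E)).2 v) ≤ idealRadius E v 𝔩 ∧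
      Valued.v ((m : v.adicCompletion E)) * Valued.v ((m : v.adicCompletion E)) *
        Valued.v ((((((diagUnit b.2 0)⁻¹ * diagUnit b.2 2 : (AdeleRing (𝓞 E) E)ˣ)) : AdeleRing (𝓞 E) E)).2 v) *
          Valued.v ((halfAdele : AdeleRing (𝓞 E) E).2 v) ≤ idealRadius E v 𝔩 ∧
      Valued.v ((m : v.adicCompletion E)) * Valued.v ((((((diagUnit b.2 1)⁻¹ * diagUnit b.2 2 :
        (AdeleRing (𝓞 E) E)ˣ)) : AdeleRing (𝓞 E) E)).2 v) * Valued.v (x₀.2 v) ≤ idealRadius E v 𝔩 ∧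
      Valued.v ((m : v.adicCompletion E)) * Valued.v (α.2 v) * Valued.v ((conjAdele F E c x₀).2 v) ≤
        idealRadius E v 𝔩 := by
    intro 𝔩 h𝔩 v
    have pick : ∀ {X : WithZero (Multiplicative ℤ)},
        X ≤ WithZero.exp (n : ℤ) * WithZero.exp (n : ℤ) * WithZero.exp (n : ℤ) → (v ∉ T' → X ≤ 1) →
        Valued.v ((m : v.adicCompletion E)) * X ≤ idealRadius E v 𝔩 := fun hX3 hX1 => by
      rcases h𝔩 with rfl | rfl
      · exact (key v _ hX3 hX1).1
      · exact (key v _ hX3 hX1).2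
    have e1 : ∀ {X : WithZero (Multiplicative ℤ)}, X ≤ WithZero.exp (n : ℤ) →
        X ≤ WithZero.exp (n : ℤ) * WithZero.exp (n : ℤ) * WithZero.exp (n : ℤ) := fun hX =>
      hX.trans (le_mul_of_one_le_left' (one_le_mul hexp1 hexp1))
    have e2 : ∀ {X Y : WithZero (Multiplicative ℤ)}, X ≤ WithZero.exp (n : ℤ) → Y ≤ WithZero.exp (n : ℤ) →
        X * Y ≤ WithZero.exp (n : ℤ) * WithZero.exp (n : ℤ) * WithZero.exp (n : ℤ) := fun hX hY =>
      (mul_le_mul' hX hY).trans (le_mul_of_one_le_right' hexp1)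
    refine ⟨pick (e1 (hαn v)) (hα1 v), pick (e1 (hγn v)) (hγ1 v), ?_, ?_, ?_⟩
    · -- `|m|² |β| |½| ≤ |m| · (|α| |γ| |½|)`
      have hre : Valued.v ((m : v.adicCompletion E)) * Valued.v ((m : v.adicCompletion E)) *
          Valued.v ((((((diagUnit b.2 0)⁻¹ * diagUnit b.2 2 : (AdeleRing (𝓞 E) E)ˣ)) : AdeleRing (𝓞 E) E)).2 v) *
            Valued.v ((halfAdele : AdeleRing (𝓞 E) E).2 v) =
          Valued.v ((m : v.adicCompletion E)) * (Valued.v ((m : v.adicCompletion E)) *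
            (Valued.v (α.2 v) * Valued.v ((((((diagUnit b.2 1)⁻¹ * diagUnit b.2 2 : (AdeleRing (𝓞 E) E)ˣ)) :
              AdeleRing (𝓞 E) E)).2 v)) * Valued.v ((halfAdele : AdeleRing (𝓞 E) E).2 v)) := by
        rw [hβeq]; ac_rfl
      rw [hre]
      refine pick ?_ ?_
      · calc Valued.v ((m : v.adicCompletion E)) * (Valued.v (α.2 v) * Valued.v ((((((diagUnit b.2 1)⁻¹ *
              diagUnit b.2 2 : (AdeleRing (𝓞 E) E)ˣ)) : AdeleRing (𝓞 E) E)).2 v)) *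
              Valued.v ((halfAdele : AdeleRing (𝓞 E) E).2 v)
            ≤ 1 * (WithZero.exp (n : ℤ) * WithZero.exp (n : ℤ)) * WithZero.exp (n : ℤ) :=
              mul_le_mul' (mul_le_mul' (hm1 v) (mul_le_mul' (hαn v) (hγn v))) (hhn v)
          _ = _ := by rw [one_mul]
      · intro hv
        exact mul_le_one' (mul_le_one' (hm1 v) (mul_le_one' (hα1 v hv) (hγ1 v hv))) (hh1 v hv)
    · rw [mul_assoc]
      exact pick (e2 (hγn v) (hxn v)) fun hv => mul_le_one' (hγ1 v hv) (hx1 v hv)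
    · rw [mul_assoc]
      exact pick (e2 (hαn v) (hcxn v)) fun hv => mul_le_one' (hα1 v hv) (hcx1 v hv)
  -- feed ★ 2E
  refine hval_of_mem_torusConj_image hc t htor hfix b 𝔫 (fun v => ?_) (fun v => ?_) hu
  · rw [hMv]; exact five 𝔫 (Or.inl rfl) v
  · rw [hMv]; exact five (c⁻¹ • 𝔫) (Or.inr rfl) v

/-- **THE LEVEL DEPTH ON THE SIEGEL SET — the `hdepth` hypothesis of ★ `truncatedKernelIntegrable_of_levelDepth`
(`UnitaryGroupTruncatedKernelIntegrableOfSiegel`), DISCHARGED.**  For `Ω ⊆ B(𝔸_F)` compact, a torus set `S_T`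
(`torusPart t = t`) whose entries satisfy `d₀(t) = w · posRealIdele r`, `d₁(t) ∈ W` (`w ∈ W`, `W ⊆ 𝕀_E` compact — row
H9a's EXPORT) and every level `𝔫 ≠ 0`, there is a RATIONAL Borel element `β` (the diagonal `t_m = diag(m⁻¹, 1, m)`,
`m ∈ ℕ`, of ★ `exists_rational_torus_diag`) such that for every `b` in the Siegel set `Ω · S_T · (B(𝔸_F) ∩ K_U)` and
every `u` in the dilated fundamental domain `β⁻¹ 𝓕_N β` of `N(F)`, the off-diagonal entries of `π(b⁻¹ u b)` and their
`c`-conjugates are divisible by `𝔫` at every finite place (`|e_v| ≤ |𝔫|_v`).  PROOF = ★ 2E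
`hval_of_mem_torusConj_image` (A-p13: ten valuation inequalities in `|m|_v`, the root values `d₀⁻¹d₁, d₁⁻¹d₂, d₀⁻¹d₂`
of `b`, `x₀(b)`, `c x₀(b)` and `|½|_v`) fed by §2–§3 (the finite shadows of these data on the Siegel set lie in a
compact of `𝔸_E^∞`), ★ `exists_finset_nat_forall_valued_le_of_isCompact` (A-p09: `≤ 1` off a finite `T`, `≤ exp n`
everywhere) and ★ `exists_natCast_valued_mul_exp_le` (A-p09: `m ∈ ℕ` with `|m|_v ≤ 1` and `|m|_v exp(3n) ≤ |𝔫|_v ∧ |c⁻¹𝔫|_v`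
on `T ∪ cT ∪ supp 𝔫 ∪ supp c⁻¹𝔫`). The height guard `1 ≤ H(b)` is not used.
[cite: Rogawski1990, §2.2 (p. 13)] [cite: CasselsFrohlichANT1967, Ch. II §16] -/
theorem exists_rational_borel_forall_valuation_conj_le (hc : c * c = 1)
    {Ω ST : Set (borelAdelic F E c 3)} (hΩ : IsCompact Ω) {W : Set (AdeleRing (𝓞 E) E)ˣ}
    (hW : IsCompact W) (hSTt : ∀ t ∈ ST, torusPart t = t)
    (hexp : ∀ t ∈ ST, ∃ w ∈ W, ∃ r : ℝ≥0ˣ, diagUnit t.2 0 = w * posRealIdele E r ∧ diagUnit t.2 1 ∈ W)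
    {𝔫 : Ideal (𝓞 E)} (h𝔫 : 𝔫 ≠ 0) :
    ∃ β : borelAdelic F E c 3, (β : (quasiSplit F E c 3).Adelic) ∈ (quasiSplit F E c 3).arithmeticSubgroup ∧
      ∀ b ∈ Ω * ST * {k : borelAdelic F E c 3 |
          adelicVal F E c 3 ((StdForm.antidiagonal 3).over E) (k : (quasiSplit F E c 3).Adelic) ∈
            standardMaximalCompactGL 3 E},
      1 ≤ borelHeight (b : (quasiSplit F E c 3).Adelic) →
      ∀ u ∈ (fun v : adelicUnipotent F E c 3 =>
          (⟨(β : (quasiSplit F E c 3).Adelic)⁻¹ * (v : (quasiSplit F E c 3).Adelic) * (β : (quasiSplit F E c 3).Adelic),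
            borel_inv_mul_mul_mem_adelicUnipotent β v⟩ : adelicUnipotent F E c 3)) '' heisFundamentalDomain F E c hc,
        ∀ i j : Fin 3, i ≠ j → ∀ v : HeightOneSpectrum (𝓞 E),
          Valued.v ((((adelicVal F E c 3 _ ((b : (quasiSplit F E c 3).Adelic)⁻¹ *
              (u : (quasiSplit F E c 3).Adelic) * (b : (quasiSplit F E c 3).Adelic)) :
            GL (Fin 3) (AdeleRing (𝓞 E) E)) : Matrix (Fin 3) (Fin 3) (AdeleRing (𝓞 E) E)) i j).2 v) ≤
              idealRadius E v 𝔫 ∧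
          Valued.v ((conjAdele F E c (((adelicVal F E c 3 _ ((b : (quasiSplit F E c 3).Adelic)⁻¹ *
              (u : (quasiSplit F E c 3).Adelic) * (b : (quasiSplit F E c 3).Adelic)) :
            GL (Fin 3) (AdeleRing (𝓞 E) E)) : Matrix (Fin 3) (Fin 3) (AdeleRing (𝓞 E) E)) i j)).2 v) ≤
              idealRadius E v 𝔫 :=
  exists_rational_borel_forall_valuation_conj_le_of_letters
    (fun hC => exists_finset_nat_forall_valued_le_of_isCompact (K := E) hC)
    (fun T n r hr => exists_natCast_valued_mul_exp_le (K := E) T n r hr) hc hΩ hW hSTt hexp h𝔫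

end Depth

end UnitaryGroup

end Literature.NumberTheory.Automorphic
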